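import Mathlib
import HarnessLib
import Literature.MathematicalPhysics.QuantumLattice.KohnLuttinger
import Literature.MathematicalPhysics.QuantumLattice.KohnLuttingerLindhardMeasurable
import Literature.Computability.MetaComplexity.TaylorCosineMinorants
import Summits.HubbardSuperconductivity.HubbardSuperconductivity.Theorems.ChiralWindowCwKLChiralWindowMuWindow
import Summits.HubbardSuperconductivity.HubbardSuperconductivity.Theorems.KLProgrammeMuOfDopingWindowConvex
import Summits.HubbardSuperconductivity.HubbardSuperconductivity.Theorems.KLProgrammeFermiSeaConvex
import Summits.HubbardSuperconductivity.HubbardSuperconductivity.Theorems.WeakCouplingBCSDefsFermiSeaPolygonCert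

/-!
# Route `WeakCouplingBCS` / `KLProgramme` — SOUNDNESS (part I) of the polygon certificates for the free Fermi-sea area
# (`FSPoly.ICert`, `FSPoly.OCert` of `WeakCouplingBCSDefsFermiSeaPolygonCert.lean`)

For `c > 0` let `R_c = {(x, y) | |x + y| < π, |x - y| < π, c < cos x + cos y}` (`FSPoly.fermiSeaCoord c`), the Fermi sea of
`ε₀ = squareDispersion 1 0` at energy `-2c` read in the coordinates `k ↦ (k₀, k₁)`; `n(-2c) = 2 vol / (2π)²`
(`kl_mu_filling_eq`).  We prove:

* `FSPoly.cosLoQ_le_cos`, `FSPoly.cos_le_cosUpQ` — the rational Taylor polynomials `T₇`, `T₈` enclose `cos` (cast of the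
  tree's all-orders bounds `cosTaylorSum_le_cos` / `cos_le_cosTaylorSum`).
* `FSPoly.ICert.filling_ge` — an accepted INSCRIBED certificate gives `area / (2π²) ≤ n(-2c)`: every certified vertex and
  its mirror lie in `R_c`, consecutive symmetric trapezoids lie in `R_c` by convexity (`convex_fermiSeaCoord`,
  `trapezoid_subset_of_convex`), they are disjoint (increasing abscissae) with the stated areas (`volume_trapezoid`), and
  `vol R_c ≤ vol({ε₀ < -2c} ∩ BZ)` (`volume_fermiSeaCoord_le`).
* `FSPoly.fermiSeaCoord_halfplane` — the SUPPORTING HALF-PLANE of the convex sea at a boundary point `P = (x₀, y₀)`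
  (`cos x₀ + cos y₀ = c`, `|x₀| + |y₀| < π`): every `q ∈ R_c` has `sin x₀ (q.1 - x₀) + sin y₀ (q.2 - y₀) < 0`.  Proof: in
  `u = (x+y)/2`, `v = (x-y)/2` one has `cos x + cos y = 2 cos u cos v`, and `log cos` is concave on `(-π/2, π/2)`
  (`muWin_concaveOn_log_cos`), so the tangent-line inequalities of `log cos` at `u₀`, `v₀` (Mathlib
  `ConcaveOn.slope_le_of_hasDerivAt` / `le_slope_of_hasDerivAt`) bound `log cos u + log cos v > log cos u₀ + log cos v₀`
  linearly; the identity `2 cos u₀ cos v₀ (tan u₀ Δu + tan v₀ Δv) = sin x₀ Δx + sin y₀ Δy` finishes.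
* the CIRCUMSCRIBED soundness `FSPoly.OCert.filling_le` is in the companion module
  `WeakCouplingBCSKlCertFermiSeaPolygonOuterSound.lean` (it consumes the half-plane lemma of this file).

Folklore throughout; no definitions (the data formats live in the `Defs` module).
-/

noncomputable section

-- the tree's namespace `Summit.<Summit>.<Problem>.Theorems` repeats the summit name by design (D-0017)
set_option linter.dupNamespace false

namespace Summit.HubbardSuperconductivity.HubbardSuperconductivity.Theorems

namespace FSPoly

open MeasureTheory Set Literature.MathematicalPhysics.QuantumLattice

/-! ### Taylor enclosures of `cos` over `ℚ`, cast to `ℝ` -/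

/-- The rational Taylor polynomial is the raw real Taylor sum of `TaylorCosineMinorants`. [folklore] -/
theorem cast_cosTaylorQ (M : ℕ) (x : ℚ) :
    ((cosTaylorQ M x : ℚ) : ℝ) =
      ∑ i ∈ Finset.range (M + 1), (-1 : ℝ) ^ i * (x : ℝ) ^ (2 * i) / ((2 * i).factorial : ℝ) := by
  induction M with
  | zero => simp [cosTaylorQ]
  | succ M ih =>
    rw [Finset.sum_range_succ, ← ih, cosTaylorQ]
    push_cast
    ring

/-- `cosLoQ x ≤ cos x` (odd order `M = 7`). [folklore] -/
theorem cosLoQ_le_cos (x : ℚ) : ((cosLoQ x : ℚ) : ℝ) ≤ Real.cos (x : ℝ) := by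
  rw [cosLoQ, cast_cosTaylorQ]
  exact Literature.Computability.MetaComplexity.cosTaylorSum_le_cos (M := 7) (by decide) _

/-- `cos x ≤ cosUpQ x` (even order `M = 8`). [folklore] -/
theorem cos_le_cosUpQ (x : ℚ) : Real.cos (x : ℝ) ≤ ((cosUpQ x : ℚ) : ℝ) := by
  rw [cosUpQ, cast_cosTaylorQ]
  exact Literature.Computability.MetaComplexity.cos_le_cosTaylorSum (M := 8) (by decide) _

/-! ### Elementary facts about the coordinate Fermi sea `R_c` -/

/-- `R_c` is the set of `convex_fermiSeaCoord` (definitional unfolding). [folklore] -/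
theorem fermiSeaCoord_eq (c : ℝ) : fermiSeaCoord c =
    {q : ℝ × ℝ | |q.1 + q.2| < Real.pi ∧ |q.1 - q.2| < Real.pi ∧ c < Real.cos q.1 + Real.cos q.2} := rfl

/-- `|a| + |b| = max |a + b| |a - b|`, in the form: both `|a + b| < π` and `|a - b| < π` give `|a| + |b| < π`. [folklore] -/
theorem abs_add_abs_lt_of_abs_add_abs_sub {a b r : ℝ} (h1 : |a + b| < r) (h2 : |a - b| < r) : |a| + |b| < r := by
  rcases abs_lt.1 h1 with ⟨h1a, h1b⟩
  rcases abs_lt.1 h2 with ⟨h2a, h2b⟩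
  rcases le_total 0 a with ha | ha <;> rcases le_total 0 b with hb | hb
  · rw [abs_of_nonneg ha, abs_of_nonneg hb]; linarith
  · rw [abs_of_nonneg ha, abs_of_nonpos hb]; linarith
  · rw [abs_of_nonpos ha, abs_of_nonneg hb]; linarith
  · rw [abs_of_nonpos ha, abs_of_nonpos hb]; linarith

/-- Membership in `R_c` from `|x| + |y| < π` and `c < cos x + cos y`. [folklore] -/
theorem mem_fermiSeaCoord' {c x y : ℝ} (hxy : |x| + |y| < Real.pi) (hc : c < Real.cos x + Real.cos y) :
    (x, y) ∈ fermiSeaCoord c :=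
  mem_fermiSeaCoord hxy hc

/-- A point of `R_c` has `|x| + |y| < π`. [folklore] -/
theorem abs_add_abs_lt_pi_of_mem {c : ℝ} {q : ℝ × ℝ} (hq : q ∈ fermiSeaCoord c) : |q.1| + |q.2| < Real.pi :=
  abs_add_abs_lt_of_abs_add_abs_sub hq.1 hq.2.1

/-- `R_c` is invariant under `(x, y) ↦ (|x|, |y|)`. [folklore] -/
theorem abs_mem_fermiSeaCoord {c : ℝ} {q : ℝ × ℝ} (hq : q ∈ fermiSeaCoord c) : (|q.1|, |q.2|) ∈ fermiSeaCoord c := by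
  refine mem_fermiSeaCoord' ?_ ?_
  · rw [abs_abs, abs_abs]; exact abs_add_abs_lt_pi_of_mem hq
  · rw [Real.cos_abs, Real.cos_abs]; exact hq.2.2

/-! ### Inscribed polygons: soundness -/

/-- A certified vertex lies in `R_c` together with its mirror image, and has `y ≥ 0`. [folklore] -/
theorem IVert.mem_of_ok {c : ℚ} {v : IVert} (h : v.ok c = true) :
    ((v.x : ℝ), (v.y : ℝ)) ∈ fermiSeaCoord (c : ℝ) ∧ ((v.x : ℝ), -(v.y : ℝ)) ∈ fermiSeaCoord (c : ℝ) ∧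
      (0 : ℝ) ≤ (v.y : ℝ) := by
  simp only [IVert.ok, Bool.and_eq_true, decide_eq_true_eq] at h
  obtain ⟨⟨h0, h1⟩, h2⟩ := h
  have h0' : (0 : ℝ) ≤ (v.y : ℝ) := by exact_mod_cast h0
  have h1' : |(v.x : ℝ)| + (v.y : ℝ) < Real.pi := by
    have : ((|v.x| + v.y : ℚ) : ℝ) < ((piLoQ : ℚ) : ℝ) := by exact_mod_cast h1
    have hpiQ : ((piLoQ : ℚ) : ℝ) < Real.pi := by rw [piLoQ]; push_cast; linarith [Real.pi_gt_d6]
    push_cast at this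
    linarith
  have h2' : (c : ℝ) < Real.cos (v.x : ℝ) + Real.cos (v.y : ℝ) := by
    have : ((c : ℚ) : ℝ) < ((cosLoQ v.x + cosLoQ v.y : ℚ) : ℝ) := by exact_mod_cast h2
    push_cast at this
    linarith [cosLoQ_le_cos v.x, cosLoQ_le_cos v.y]
  refine ⟨mem_fermiSeaCoord' (by rwa [abs_of_nonneg h0']) h2', mem_fermiSeaCoord' ?_ ?_, h0'⟩
  · rwa [abs_neg, abs_of_nonneg h0']
  · rwa [Real.cos_neg]

/-- **Soundness of the inscribed chain** (induction on the vertex list): the polygon from `v` on lies in `R_c`, is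
measurable, lies over `{x > v.x}`, and has volume exactly `areaList v rest ≥ 0`. [folklore] -/
theorem ICert.polygon_spec {c : ℚ} (hc : 0 < c) :
    ∀ (rest : List IVert) (v : IVert), ICert.chainOK c v rest = true →
      ICert.polygon v rest ⊆ fermiSeaCoord (c : ℝ) ∧ MeasurableSet (ICert.polygon v rest) ∧
        ICert.polygon v rest ⊆ {q : ℝ × ℝ | (v.x : ℝ) < q.1} ∧
        volume (ICert.polygon v rest) = ENNReal.ofReal ((ICert.areaList v rest : ℚ) : ℝ) ∧
        (0 : ℚ) ≤ ICert.areaList v rest := by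
  have hconv : Convex ℝ (fermiSeaCoord ((c : ℚ) : ℝ)) := by
    rw [fermiSeaCoord_eq]; exact convex_fermiSeaCoord (by exact_mod_cast hc)
  intro rest
  induction rest with
  | nil =>
    intro v _
    simp [ICert.polygon, ICert.areaList]
  | cons w rest ih =>
    intro v h
    simp only [ICert.chainOK, Bool.and_eq_true, decide_eq_true_eq] at h
    obtain ⟨⟨hv, hvw⟩, hrest⟩ := h
    obtain ⟨hwR, hwM, hwS, hwV, hwA⟩ := ih w hrest
    obtain ⟨mv, nv, hvy⟩ := IVert.mem_of_ok hv
    have hw0 : w.ok c = true := by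
      cases rest with
      | nil => simpa [ICert.chainOK] using hrest
      | cons u rest' =>
        simp only [ICert.chainOK, Bool.and_eq_true, decide_eq_true_eq] at hrest
        exact hrest.1.1
    obtain ⟨mw, nw, hwy⟩ := IVert.mem_of_ok hw0
    have hvw' : ((v.x : ℚ) : ℝ) < ((w.x : ℚ) : ℝ) := by exact_mod_cast hvw
    -- the new trapezoid
    have hT : trap (v.x : ℝ) (w.x : ℝ) (v.y : ℝ) (w.y : ℝ) ⊆ fermiSeaCoord ((c : ℚ) : ℝ) :=
      trapezoid_subset_of_convex hconv hvw' mv nv mw nw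
    have hTm : MeasurableSet (trap (v.x : ℝ) (w.x : ℝ) (v.y : ℝ) (w.y : ℝ)) := measurableSet_trapezoid _ _ _ _
    have hTv : volume (trap (v.x : ℝ) (w.x : ℝ) (v.y : ℝ) (w.y : ℝ)) =
        ENNReal.ofReal (((w.x : ℝ) - v.x) * ((v.y : ℝ) + w.y)) := volume_trapezoid hvw' hvy hwy
    have hTs : trap (v.x : ℝ) (w.x : ℝ) (v.y : ℝ) (w.y : ℝ) ⊆ Ioc (v.x : ℝ) (w.x : ℝ) ×ˢ (univ : Set ℝ) :=
      regionBetween_subset _ _ _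
    refine ⟨union_subset hT hwR, hTm.union hwM, ?_, ?_, ?_⟩
    · rintro q (hq | hq)
      · exact ((hTs hq).1).1
      · have := hwS hq
        simp only [mem_setOf_eq] at this ⊢
        linarith
    · have hdisj : Disjoint (trap (v.x : ℝ) (w.x : ℝ) (v.y : ℝ) (w.y : ℝ)) (ICert.polygon w rest) := by
        rw [Set.disjoint_left]
        intro q hq1 hq2
        have h1 : q.1 ≤ (w.x : ℝ) := ((hTs hq1).1).2
        have h2 : (w.x : ℝ) < q.1 := hwS hq2
        linarith
      show volume (trap (v.x : ℝ) (w.x : ℝ) (v.y : ℝ) (w.y : ℝ) ∪ ICert.polygon w rest) =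
        ENNReal.ofReal ((((w.x - v.x) * (v.y + w.y) + ICert.areaList w rest : ℚ) : ℝ))
      rw [measure_union hdisj hwM, hTv, hwV]
      have ha : (0 : ℝ) ≤ ((w.x : ℝ) - v.x) * ((v.y : ℝ) + w.y) := mul_nonneg (by linarith) (by linarith)
      have hb : (0 : ℝ) ≤ ((ICert.areaList w rest : ℚ) : ℝ) := by exact_mod_cast hwA
      rw [← ENNReal.ofReal_add ha hb]
      push_cast
      ring_nf
    · show (0 : ℚ) ≤ (w.x - v.x) * (v.y + w.y) + ICert.areaList w rest
      have : (0 : ℚ) ≤ v.y := by exact_mod_cast hvy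
      have : (0 : ℚ) ≤ w.y := by exact_mod_cast hwy
      nlinarith

/-- **An accepted inscribed certificate bounds the volume of `R_c` from below by its area.** [folklore] -/
theorem ICert.area_le_volume (C : ICert) (h : C.check = true) :
    ENNReal.ofReal ((C.area : ℚ) : ℝ) ≤ volume (fermiSeaCoord (C.c : ℝ)) := by
  obtain ⟨c, vs⟩ := C
  simp only [ICert.check, Bool.and_eq_true, decide_eq_true_eq] at h
  obtain ⟨hc, hchain⟩ := h
  cases vs with
  | nil => simp at hchain
  | cons v rest =>
    simp only at hchain
    obtain ⟨hR, -, -, hV, -⟩ := ICert.polygon_spec hc rest v hchain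
    show ENNReal.ofReal (((ICert.areaList v rest : ℚ) : ℝ)) ≤ volume (fermiSeaCoord (c : ℝ))
    rw [← hV]
    exact measure_mono hR

/-- **Certified lower filling bound**: an accepted inscribed certificate at level `c` gives
`area / (2π²) ≤ n(-2c)`. [folklore] -/
theorem ICert.filling_ge (C : ICert) (h : C.check = true) :
    ((C.area : ℚ) : ℝ) / (2 * Real.pi ^ 2) ≤ KohnLuttinger.filling (squareDispersion 1 0) (-2 * (C.c : ℝ)) := by
  have h1 := (C.area_le_volume h).trans (volume_fermiSeaCoord_le (C.c : ℝ))
  have h2 : ((C.area : ℚ) : ℝ) ≤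
      (volume ({p : Momentum | squareDispersion 1 0 p < -2 * (C.c : ℝ)} ∩ brillouinZone)).toReal :=
    (ENNReal.ofReal_le_iff_le_toReal (kl_mu_volume_occupied_lt_top _).ne).1 h1
  rw [kl_mu_filling_eq]
  have hpi : 0 < Real.pi := Real.pi_pos
  rw [div_le_div_iff₀ (by positivity) (by positivity)]
  nlinarith

/-! ### The supporting half-plane of the Fermi sea at a boundary point -/

/-- Tangent-line inequality for the concave function `log ∘ cos` on `(-π/2, π/2)`. [folklore] -/
theorem log_cos_le_tangent {t₀ t : ℝ} (h₀ : t₀ ∈ Ioo (-(Real.pi / 2)) (Real.pi / 2))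
    (ht : t ∈ Ioo (-(Real.pi / 2)) (Real.pi / 2)) :
    Real.log (Real.cos t) ≤ Real.log (Real.cos t₀) - Real.tan t₀ * (t - t₀) := by
  have hderiv : HasDerivAt (fun u => Real.log (Real.cos u)) (-Real.tan t₀) t₀ := by
    have hc : Real.cos t₀ ≠ 0 := (Real.cos_pos_of_mem_Ioo h₀).ne'
    have := (Real.hasDerivAt_cos t₀).log hc
    convert this using 1
    rw [Real.tan_eq_sin_div_cos]; ring
  rcases lt_trichotomy t₀ t with hlt | heq | hgt
  · have hs := muWin_concaveOn_log_cos.slope_le_of_hasDerivAt h₀ ht hlt hderiv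
    rw [slope_def_field] at hs
    rw [div_le_iff₀ (sub_pos.2 hlt)] at hs
    linarith
  · subst heq; simp
  · have hs := muWin_concaveOn_log_cos.le_slope_of_hasDerivAt ht h₀ hgt hderiv
    rw [slope_def_field] at hs
    rw [le_div_iff₀ (sub_pos.2 hgt)] at hs
    linarith

/-- The supporting half-plane in the rotated variables `u₀ = (x₀+y₀)/2`, `v₀ = (x₀-y₀)/2`. [folklore] -/
theorem fermiSeaCoord_halfplane_aux {c u₀ v₀ : ℝ}
    (hP : Real.cos (u₀ + v₀) + Real.cos (u₀ - v₀) = c)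
    (hu₀ : u₀ ∈ Ioo (-(Real.pi / 2)) (Real.pi / 2)) (hv₀ : v₀ ∈ Ioo (-(Real.pi / 2)) (Real.pi / 2))
    {q : ℝ × ℝ} (hq : q ∈ fermiSeaCoord c) :
    Real.sin (u₀ + v₀) * (q.1 - (u₀ + v₀)) + Real.sin (u₀ - v₀) * (q.2 - (u₀ - v₀)) < 0 := by
  obtain ⟨hq1, hq2, hq3⟩ := hq
  set u : ℝ := (q.1 + q.2) / 2 with hu_def
  set v : ℝ := (q.1 - q.2) / 2 with hv_def
  have hu : u ∈ Ioo (-(Real.pi / 2)) (Real.pi / 2) :=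
    ⟨by rw [hu_def]; linarith [(abs_lt.1 hq1).1], by rw [hu_def]; linarith [(abs_lt.1 hq1).2]⟩
  have hv : v ∈ Ioo (-(Real.pi / 2)) (Real.pi / 2) :=
    ⟨by rw [hv_def]; linarith [(abs_lt.1 hq2).1], by rw [hv_def]; linarith [(abs_lt.1 hq2).2]⟩
  have hcu₀ : 0 < Real.cos u₀ := Real.cos_pos_of_mem_Ioo hu₀
  have hcv₀ : 0 < Real.cos v₀ := Real.cos_pos_of_mem_Ioo hv₀
  have hcu : 0 < Real.cos u := Real.cos_pos_of_mem_Ioo hu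
  have hcv : 0 < Real.cos v := Real.cos_pos_of_mem_Ioo hv
  -- product forms of the two sums of cosines
  have hP' : 2 * Real.cos u₀ * Real.cos v₀ = c := by
    rw [← hP, Real.cos_add_cos]
    congr 2 <;> ring_nf
  have hQ' : c < 2 * Real.cos u * Real.cos v := by
    have : Real.cos q.1 + Real.cos q.2 = 2 * Real.cos u * Real.cos v := by
      rw [Real.cos_add_cos]
    linarith
  -- logarithms
  have hlog : Real.log (Real.cos u₀) + Real.log (Real.cos v₀) < Real.log (Real.cos u) + Real.log (Real.cos v) := by
    rw [← Real.log_mul hcu₀.ne' hcv₀.ne', ← Real.log_mul hcu.ne' hcv.ne']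
    exact Real.log_lt_log (mul_pos hcu₀ hcv₀) (by nlinarith)
  have htu := log_cos_le_tangent hu₀ hu
  have htv := log_cos_le_tangent hv₀ hv
  have hT : Real.tan u₀ * (u - u₀) + Real.tan v₀ * (v - v₀) < 0 := by linarith
  -- back to `(x, y)`
  have hexp : Real.sin (u₀ + v₀) * (q.1 - (u₀ + v₀)) + Real.sin (u₀ - v₀) * (q.2 - (u₀ - v₀)) =
      2 * Real.cos u₀ * Real.cos v₀ * (Real.tan u₀ * (u - u₀) + Real.tan v₀ * (v - v₀)) := by
    rw [Real.tan_eq_sin_div_cos, Real.tan_eq_sin_div_cos, Real.sin_add, Real.sin_sub, hu_def, hv_def]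
    field_simp
    ring
  rw [hexp]
  have h2 : 0 < 2 * Real.cos u₀ * Real.cos v₀ := by positivity
  exact mul_neg_of_pos_of_neg h2 hT

/-- **Supporting half-plane of the convex Fermi sea.** If `P = (x₀, y₀)` lies on the Fermi curve
(`cos x₀ + cos y₀ = c > 0`) inside the open diamond, then every `q ∈ R_c` satisfies
`sin x₀ (q.1 - x₀) + sin y₀ (q.2 - y₀) < 0` (the outward normal of the sea at `P` is `(sin x₀, sin y₀)`).
Proof: concavity of `log cos` in the variables `(x ± y)/2`. [folklore] -/
theorem fermiSeaCoord_halfplane {c x₀ y₀ : ℝ} (hP : Real.cos x₀ + Real.cos y₀ = c)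
    (hd : |x₀| + |y₀| < Real.pi) {q : ℝ × ℝ} (hq : q ∈ fermiSeaCoord c) :
    Real.sin x₀ * (q.1 - x₀) + Real.sin y₀ * (q.2 - y₀) < 0 := by
  obtain ⟨u₀, v₀, rfl, rfl⟩ : ∃ u₀ v₀ : ℝ, x₀ = u₀ + v₀ ∧ y₀ = u₀ - v₀ :=
    ⟨(x₀ + y₀) / 2, (x₀ - y₀) / 2, by ring, by ring⟩
  have h1 : |(u₀ + v₀) + (u₀ - v₀)| < Real.pi := lt_of_le_of_lt (abs_add_le _ _) hd
  have h2 : |(u₀ + v₀) - (u₀ - v₀)| < Real.pi :=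
    lt_of_le_of_lt (by simpa only [sub_eq_add_neg, abs_neg] using abs_add_le (u₀ + v₀) (-(u₀ - v₀))) hd
  have hu₀ : u₀ ∈ Ioo (-(Real.pi / 2)) (Real.pi / 2) := by
    have := abs_lt.1 h1; constructor <;> linarith
  have hv₀ : v₀ ∈ Ioo (-(Real.pi / 2)) (Real.pi / 2) := by
    have := abs_lt.1 h2; constructor <;> linarith
  exact fermiSeaCoord_halfplane_aux hP hu₀ hv₀ hq

end FSPoly

end Summit.HubbardSuperconductivity.HubbardSuperconductivity.Theorems

end
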